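import Literature.NumberTheory.LFunctions.VonMangoldtLaplaceProgressions
import HarnessLib

/-!
# The Landau step for the residue class `1 mod q` WITHOUT the Distinct Zero Conjecture

Support file (everything PROVED, no definitions, no named facts), companion of
`Literature/NumberTheory/LFunctions/VonMangoldtLaplaceProgressions.lean`. There the Landau step for
`E_a + E_b` (`E_a(t) = ∑_{n ≡ a (q)} Λ(n)e^{-nt} − e^{-t}/(φ(q)t)`) is run under the Distinct Zero
Conjecture mod `q` (`coeff_eq_zero_of_LFunction_eq_zero`, `apply_inv_add_apply_inv_eq_zero`):
a zero `ρ` shared by several `L(·, χ)` could make the weights `χ(a)⁻¹ + χ(b)⁻¹` cancel. For the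
class `a = b = 1` no conjecture is needed, because all the weights are EQUAL (`χ(1)⁻¹ = 1`): the
combination `∑_χ L'/L(s, χ)` is the logarithmic derivative of the PRODUCT `∏_χ L(s, χ)`, whose
zeros are poles of positive integral residue and cannot cancel. This is the remark that
Bhowmik–Halupczok–Matsumoto–Suzuki's Theorem 1 (2) (Mathematika 65 (2019), arXiv:1704.06103), which
is stated under DZC for all `(a, b)`, holds unconditionally for `(a, b) = (1, 1)` — in their
Proposition 3 the residue at `ρ_q + 1` is `−φ(q)⁻²ρ_q⁻¹ ∑_{χ : L(ρ_q, χ) = 0} (χ̄(a) + χ̄(b)) m_χ(ρ_q)`,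
and for `a = b = 1` this is `−2φ(q)⁻²ρ_q⁻¹ ∑ m_χ(ρ_q) ≠ 0` without any hypothesis
[cite: BhowmikHalupczokMatsumotoSuzuki2019, Proposition 3 and proof of Theorem 1 (2)]. It is used by the barrier catalogue
(`Literature/Barriers/Parity/GoldbachAverageZerosNarrow.lean`) to record the unconditional
progression case of the entry `GoldbachAverageZeros`.

* `const_eq_zero_of_LFunction_eq_zero` — if `M` is holomorphic on `Re w > θ > 0` and
  `M = Γ · (−c₀ ∑_χ L'/L(·, χ) − c₀/(w − 1))` far to the right, then `c₀ = 0` as soon as some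
  `L(·, χ₁)` has a zero with `θ < Re ρ < 1` (abstract Landau step
  `coeff_eq_zero_of_sum_logDeriv` applied to the single entire function
  `P = (w − 1)L(w, 1) · ∏_{χ ≠ 1} L(w, χ)`, Mathlib `logDeriv_prod`);
* `LFunction_ne_zero_of_errLaplace_one` — **the Landau step for `E_1`**: if `E_1(t) = O(t^{-θ})`
  at `0⁺` (`θ > 0`), then NO `L(·, χ)`, `χ (mod q)`, vanishes in `θ < Re s < 1`.

## References

* G. Bhowmik, K. Halupczok, K. Matsumoto, Y. Suzuki, Mathematika 65 (2019), 57–97,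
  arXiv:1704.06103: Proposition 3 and §7 (proof of Theorem 1 (2)).
* H. L. Montgomery, R. C. Vaughan, *Multiplicative Number Theory I*, CUP 2007, §15.1.
-/

noncomputable section

open Filter Asymptotics MeasureTheory Set Complex Finset
open scoped Topology

namespace Literature.NumberTheory.LFunctions

namespace LaplaceProgressions

open DirichletCharacter in
/-- **Landau-type lemma for `c₀ ∑_χ L'/L`, no DZC.** Let `M` be holomorphic on `Re w > θ`
(`0 < θ`) and suppose that on some half-plane `Re w > σ₁` (`σ₁ ≥ 1`)
`M(w) = Γ(w) · (−∑_χ c₀ L'(w,χ)/L(w,χ) − c₀/(w−1))` with ONE coefficient `c₀` for all Dirichlet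
characters mod `q`. Then `c₀ = 0` as soon as some `L(·, χ₁)` has a zero `ρ` with `θ < Re ρ < 1`:
with the entire function `P(w) = (w−1)L(w,1) ∏_{χ ≠ 1} L(w,χ)` one has `M/Γ = −c₀ P'/P` on
`Re w > σ₁` (logarithmic derivative of a product), `P(ρ) = 0`, and `coeff_eq_zero_of_sum_logDeriv`
applies with a one-element index set. (For `a = b = 1` the residue of
Bhowmik–Halupczok–Matsumoto–Suzuki's Proposition 3 is a sum of positive multiplicities, so no
Distinct Zero Conjecture is needed.) [cite: BhowmikHalupczokMatsumotoSuzuki2019, Proposition 3 and proof of Theorem 1 (2)] -/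
theorem const_eq_zero_of_LFunction_eq_zero {q : ℕ} [NeZero q]
    {θ : ℝ} (hθ0 : 0 < θ) {M : ℂ → ℂ}
    (hM : ∀ w : ℂ, θ < w.re → DifferentiableAt ℂ M w) (c₀ : ℂ)
    {σ₁ : ℝ} (hσ₁ : 1 ≤ σ₁)
    (hid : ∀ w : ℂ, σ₁ < w.re → M w = Complex.Gamma w *
      (-(∑ χ : DirichletCharacter ℂ q, c₀ * (deriv χ.LFunction w / χ.LFunction w)) -
        c₀ / (w - 1)))
    {χ₁ : DirichletCharacter ℂ q} {ρ : ℂ} (hρ : χ₁.LFunction ρ = 0) (h1 : θ < ρ.re)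
    (h2 : ρ.re < 1) : c₀ = 0 := by
  classical
  have hρ1 : ρ ≠ 1 := fun h ↦ by simp [h] at h2
  -- the entire functions `f_χ`
  set F : DirichletCharacter ℂ q → ℂ → ℂ :=
    Function.update (fun χ ↦ χ.LFunction) 1 (LFunctionTrivChar₁ q) with hF
  have hF1 : F 1 = LFunctionTrivChar₁ q := Function.update_self ..
  have hFne : ∀ χ, χ ≠ 1 → F χ = χ.LFunction := fun χ hχ ↦ Function.update_of_ne hχ ..
  have hF1_apply : ∀ w : ℂ, w ≠ 1 → F 1 w = (w - 1) * LFunctionTrivChar q w := by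
    intro w hw
    rw [hF1, LFunctionTrivChar₁, Function.update_of_ne hw]
  have hFd : ∀ χ, Differentiable ℂ (F χ) := by
    intro χ
    rcases eq_or_ne χ 1 with rfl | hχ
    · rw [hF1]; exact differentiable_LFunctionTrivChar₁ q
    · rw [hFne χ hχ]; exact differentiable_LFunction hχ
  -- their product
  set P : ℂ → ℂ := fun w ↦ ∏ χ, F χ w with hPdef
  have hPd : Differentiable ℂ P := fun w ↦ DifferentiableAt.fun_finsetProd fun χ _ ↦ hFd χ w
  -- the sets `U ⊇ V`
  set U : Set ℂ := {w | θ < w.re} with hU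
  set V : Set ℂ := {w | σ₁ < w.re} with hV
  have hUo : IsOpen U := isOpen_lt continuous_const continuous_re
  have hVo : IsOpen V := isOpen_lt continuous_const continuous_re
  have hVU : V ⊆ U := fun w (hw : σ₁ < w.re) ↦ show θ < w.re by linarith [h1, h2]
  have hUc : IsPreconnected U := (convex_halfSpace_re_gt θ).isPreconnected
  -- `Γ` on `U`
  have hΓd : ∀ w ∈ U, DifferentiableAt ℂ Complex.Gamma w := by
    intro w hw
    refine Complex.differentiableAt_Gamma w fun m hm ↦ ?_
    have : θ < w.re := hw
    rw [hm] at this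
    simp at this
    linarith [(m.cast_nonneg : (0 : ℝ) ≤ m)]
  have hΓ0 : ∀ w ∈ U, Complex.Gamma w ≠ 0 := fun w hw ↦
    Complex.Gamma_ne_zero_of_re_pos (hθ0.trans hw)
  -- `g = M/Γ`
  set g : ℂ → ℂ := fun w ↦ M w / Complex.Gamma w with hg
  have hgd : DifferentiableOn ℂ g U := fun w hw ↦
    ((hM w hw).div (hΓd w hw) (hΓ0 w hw)).differentiableWithinAt
  -- no `f_χ` vanishes on `V`, hence neither does `P`
  have hFV : ∀ χ, ∀ w ∈ V, F χ w ≠ 0 := by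
    intro χ w hw
    have hw : 1 < w.re := lt_of_le_of_lt hσ₁ hw
    have hw1 : w ≠ 1 := fun h ↦ by simp [h] at hw
    rcases eq_or_ne χ 1 with rfl | hχ
    · rw [hF1_apply w hw1]
      exact mul_ne_zero (sub_ne_zero.mpr hw1)
        (LFunction_ne_zero_of_one_le_re 1 (.inr hw1) hw.le)
    · rw [hFne χ hχ]
      exact LFunction_ne_zero_of_one_le_re χ (.inl hχ) hw.le
  have hPV : ∀ w ∈ V, P w ≠ 0 := fun w hw ↦
    Finset.prod_ne_zero_iff.mpr fun χ _ ↦ hFV χ w hw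
  -- `g = -c₀ P'/P` on `V`
  have hgV : ∀ w ∈ V, g w = -∑ _u : Unit, c₀ * (deriv P w / P w) := by
    intro w hw'
    have hw : 1 < w.re := lt_of_le_of_lt hσ₁ hw'
    have hw1 : w ≠ 1 := fun h ↦ by simp [h] at hw
    have hL1 : LFunctionTrivChar q w ≠ 0 := LFunction_ne_zero_of_one_le_re 1 (.inr hw1) hw.le
    -- logarithmic derivative of the product
    have hlog : deriv P w / P w = ∑ χ, deriv (F χ) w / F χ w := by
      have h := logDeriv_prod (s := (univ : Finset (DirichletCharacter ℂ q))) (f := F) (x := w)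
        (fun χ _ ↦ hFV χ w hw') (fun χ _ ↦ hFd χ w)
      simpa only [logDeriv_apply] using h
    -- the principal character carries the extra `1/(w-1)`
    have hsplit : ∑ χ, deriv (F χ) w / F χ w =
        ∑ χ : DirichletCharacter ℂ q, deriv χ.LFunction w / χ.LFunction w + 1 / (w - 1) := by
      rw [Fintype.sum_eq_add_sum_compl 1, Fintype.sum_eq_add_sum_compl 1, add_assoc,
        add_comm _ (1 / (w - 1)), ← add_assoc]
      congr 1
      · rw [hF1, deriv_LFunctionTrivChar₁_apply_of_ne_one q hw1, LFunctionTrivChar₁,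
          Function.update_of_ne hw1]
        have hw1' : (w - 1) ≠ 0 := sub_ne_zero.mpr hw1
        field_simp
      · refine Finset.sum_congr rfl fun χ hχ ↦ ?_
        have hχ : χ ≠ 1 := by simpa using hχ
        rw [hFne χ hχ]
    have hΓ : Complex.Gamma w ≠ 0 := hΓ0 w (hVU hw')
    simp only [Finset.univ_unique, Finset.sum_singleton]
    rw [hlog, hsplit, hg]
    simp only [hid w hw', ← Finset.mul_sum]
    field_simp
    ring
  -- `ρ` is a zero of `P`
  have hρU : ρ ∈ U := h1
  have h0 : P ρ = 0 := by
    have hF0 : F χ₁ ρ = 0 := by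
      rcases eq_or_ne χ₁ 1 with rfl | hχ
      · rw [hF1_apply ρ hρ1, show LFunctionTrivChar q ρ = 0 from hρ, mul_zero]
      · rw [hFne χ₁ hχ, hρ]
    exact Finset.prod_eq_zero (Finset.mem_univ χ₁) hF0
  have h2V : ((σ₁ + 1 : ℝ) : ℂ) ∈ V := by simp [hV]
  exact coeff_eq_zero_of_sum_logDeriv (ι := Unit) hUo hUc hVo hVU (f := fun _ ↦ P)
    (fun _ ↦ hPd.differentiableOn) hgd (fun _ ↦ c₀) (fun _ w hw ↦ hPV w hw) hgV h2V
    (i₀ := ()) hρU h0 (fun i hi ↦ absurd (Subsingleton.elim i ()) hi) (hVU h2V) (hPV _ h2V)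

open ArithmeticFunction.vonMangoldt in
/-- **The Landau step for `E_1`, unconditionally.** If
`E_1(t) = ∑_{n ≡ 1 (q)} Λ(n)e^{-nt} − e^{-t}/(φ(q)t) = O(t^{-θ})` as `t → 0⁺` for some `θ > 0`,
then no `L(·, χ)`, `χ (mod q)`, has a zero with `θ < Re s < 1`: the Mellin transform of `E_1` is
holomorphic on `Re s > θ` and equals `Γ(s)(−φ⁻¹∑_χ L'/L(s,χ) − φ⁻¹/(s−1))` on `Re s > 2`
(`mellin_errLaplace_eq_sum` with `χ(1)⁻¹ = 1`), so `const_eq_zero_of_LFunction_eq_zero` would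
give `φ(q)⁻¹ = 0`. (The class `1 mod q` sees every character with the same weight; compare
`apply_inv_add_apply_inv_eq_zero`, which needs DZC for general classes.)
[cite: BhowmikHalupczokMatsumotoSuzuki2019, Proposition 3 and proof of Theorem 1 (2)] -/
theorem LFunction_ne_zero_of_errLaplace_one {q : ℕ} [NeZero q] {θ : ℝ} (hθ : 0 < θ)
    (hO : (fun t : ℝ ↦ ((laplaceSeries (residueClass (1 : ZMod q)) t -
      Real.exp (-t) / ((q.totient : ℝ) * t) : ℝ) : ℂ)) =O[𝓝[>] 0] fun t ↦ t ^ (-θ))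
    (χ₁ : DirichletCharacter ℂ q) {ρ : ℂ} (h1 : θ < ρ.re) (h2 : ρ.re < 1) :
    χ₁.LFunction ρ ≠ 0 := by
  intro hρ
  have hφ : (q.totient : ℂ) ≠ 0 := by exact_mod_cast (Nat.totient_pos.mpr (NeZero.pos q)).ne'
  have hinv : (1 : ZMod q)⁻¹ = 1 := by
    have h := ZMod.inv_mul_of_unit (1 : ZMod q) isUnit_one
    rwa [mul_one] at h
  have hM : ∀ w : ℂ, θ < w.re → DifferentiableAt ℂ (mellin fun t : ℝ ↦
      ((laplaceSeries (residueClass (1 : ZMod q)) t - Real.exp (-t) / ((q.totient : ℝ) * t) : ℝ) :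
        ℂ)) w :=
    fun w hw ↦ differentiableAt_mellin_errLaplace 1 hO hw
  have hid : ∀ w : ℂ, 2 < w.re → mellin (fun t : ℝ ↦
      ((laplaceSeries (residueClass (1 : ZMod q)) t - Real.exp (-t) / ((q.totient : ℝ) * t) : ℝ) :
        ℂ)) w = Complex.Gamma w *
      (-(∑ χ : DirichletCharacter ℂ q, (q.totient : ℂ)⁻¹ * (deriv χ.LFunction w / χ.LFunction w)) -
        (q.totient : ℂ)⁻¹ / (w - 1)) := by
    intro w hw
    rw [mellin_errLaplace_eq_sum isUnit_one hw]
    simp only [hinv, map_one, mul_one]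
  exact hφ (inv_eq_zero.mp (const_eq_zero_of_LFunction_eq_zero hθ hM _ (by norm_num : (1 : ℝ) ≤ 2)
    hid hρ h1 h2))

end LaplaceProgressions

end Literature.NumberTheory.LFunctions

end
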